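import Literature.IUT.HodgeArakelov.GoodPrimeFrobenioidMonoids
import Literature.IUT.HodgeArakelov.RealifiedMonoidRigidity

/-!
# [IUTchII] Prop 4.2 (ii) / 4.4 (ii): discharge of `PointedHalfLine.IsoUnique`

Proof-only companion (DISCHARGE-L6 §0 R5) of `GoodPrimeFrobenioidMonoids.lean`: the statement
`PointedHalfLine.IsoUnique A B` — "a unique isomorphism of monoids … that maps the distinguished
element … to the distinguished element" ([IUTchII] Prop 4.2 (ii), kurims Dec-2020 manuscript
p. 124; Prop 4.4 (ii) p. 130) [cite: Mochizuki2012, Prop 4.2 (ii) p.124] — follows from the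
rigidity of `ℝ≥0` proved in `RealifiedMonoidRigidity.lean` (`NNRealAddHom.addEquiv_eq_of_apply_eq`:
an additive isomorphism of `ℝ≥0` is determined by the image of one nonzero element). No new
definitions.
-/

namespace Literature.IUT.HodgeArakelov

namespace PointedHalfLine

/-- **[IUTchII] Prop 4.2 (ii) p. 124 / Prop 4.4 (ii) p. 130, uniqueness clause, discharged**: any
isomorphism of monoids `ℝ≥0 ⥲ ℝ≥0` carrying the distinguished element of `A` to that of `B` is the
scaling isomorphism `scaleIso A B`. [cite: Mochizuki2012, Prop 4.2 (ii) p.124] -/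
theorem isoUnique_holds (A B : PointedHalfLine) : IsoUnique A B := by
  intro e he
  exact NNRealAddHom.addEquiv_eq_of_apply_eq e (scaleIso A B) A.pt_pos.ne'
    (he.trans (scaleIso_pt A B).symm)

variable (A B : PointedHalfLine) in
/-- `IsoUnique` — `_holds` alias of `isoUnique_holds` above under the fact's exact name, stated under the
prover's own binders as section variables (appended 2026-08-28, D-0026 bookkeeping: the proof term is the
existing theorem of this file; no statement, definition or attribute is edited; no new named fact; the
ledger's debt table listed the fact unproved). [cite: Mochizuki2012, Prop 4.2 (ii) p.124] -/
theorem IsoUnique_holds : IsoUnique A B :=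
  isoUnique_holds A B

end PointedHalfLine

end Literature.IUT.HodgeArakelov
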